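import Literature.NumberTheory.ConnesConsani2021.ProlateTraceIdentities
import Literature.NumberTheory.ConnesConsani2021.SineIntegralAsymptotics
import HarnessLib

/-!
# The tail mass `Σ_{n ∉ F} λ(n)²` of the prolate eigenvalues and the numeral `Λ = Σ_n λ(n)² ≈ 2.2375`

LINE 1 — FRAMING: RH-FREE classical analysis (Slepian `λ = 1` prolate family, sine-integral numerics);
cell rh-crit, corpus C1, seat t2 (hand #1 for seat t7's (E-a) tail theorem, cc-lead R100 (1) / R102 (1)(c));
bears_on: W-C/W-P — K3 `WindowSpectralBound` (stmt 19306), (E-a) certificate: the HIGH-MODE TAIL INPUT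
`ε_F := Λ − Σ_{n∈F} λ(n)²` of the design of record (ii)-FULL, and the rational enclosure of `Λ` the Tier-2
kernel subtracts from.  WHAT THIS IS NOT: a certificate, an enclosure of `ϖ`, or any claim about RH — nothing
in this file mentions `ζ`, the critical strip or RH, and nothing here bears on the truth of RH.

Source: A. Connes, C. Consani, *Weil positivity and trace formula, the archimedean place*, Selecta Math.
(N.S.) 27 (2021) 77 = arXiv:2006.13771 [bib `ConnesConsani2021`], Remark 4.6 (i) §4 p. 18 (arXiv item
Remark 26): `Tr(𝒫̂₁𝒫₁) = Σ_n λ(n)² = δ(1) = 2(Si(4π)/(4π) + 1)`, "both sides are `∼ 2.237484835`"; the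
numerals of `λ(n)` on p. 16 (`λ(4) = 0.00273…`, `λ(5) = −0.0000763…`).  In the tree the identity is the
THEOREM `hasSum_prolateEigen_sq_sinIntegral` (`ProlateTraceIdentities.lean`, completeness of the `ξ_n`
discharged) and the sine-integral numerics come from `abs_sinIntegral_four_pi_sub_le`
(`SineIntegralAsymptotics.lean`: `|Si(4π) − (π/2 − 1/(4π) + 2/(4π)³)| ≤ 6/(4π)⁴`).

## What is here (theorems only: 0 definitions, 0 named facts)

* `tsum_sq_prolateEigen` — `Σ' λ(n)² = Λ := 2(Si(4π)/(4π) + 1)` (summability itself is the tree's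
  `summable_sq_prolateEigen`, `ProlateProjectionsAngleProofs.lean`);
* `sum_sq_prolateEigen_le_total` — every finite partial sum is `≤ Λ`;
* `hasSum_sq_prolateEigen_compl`, `tsum_sq_prolateEigen_compl` — the INDEX-FREE tail over the complement of
  ANY finset `F`: `Σ_{n ∉ F} λ(n)² = Λ − Σ_{k∈F} λ(k)²` (matches `SlopeCert`'s four un-numbered members
  `F = {k0, k1, k2, k3}` of `EpsSlopeEnclosure.lean`);
* `tsum_sq_prolateEigen_compl_le`, `sum_sq_prolateEigen_le_of_disjoint`, `sq_prolateEigen_le_of_notMem'`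
  — the usable bounds from a certified lower bound `M ≤ Σ_{k∈F} λ(k)²`;
* `two_mul_sinIntegral_div_add_one_le`, `le_two_mul_sinIntegral_div_add_one` — the EXACT enclosure
  `9/4 − 2/(4π)² + 4/(4π)⁴ − 12/(4π)⁵ ≤ Λ ≤ 9/4 − 2/(4π)² + 4/(4π)⁴ + 12/(4π)⁵`;
* `two_mul_sinIntegral_div_add_one_le_numeral`, `numeral_le_two_mul_sinIntegral_div_add_one` — the decimals
  `2.23745 ≤ Λ ≤ 2.23754` (print: `2.237484835`).
-/

noncomputable section

open Real Set Filter Finset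

namespace Literature.NumberTheory.ConnesConsani2021

open Literature.NumberTheory.LFunctions

/-! ## The total mass `Λ` and finite partial sums -/

/-- `Σ' λ(n)² = Λ = 2(Si(4π)/(4π) + 1)`. [cite: ConnesConsani2021, Remark 4.6 (i) §4 p. 18 (arXiv item Remark 26, p0018:L2–L4)] -/
theorem tsum_sq_prolateEigen :
    ∑' n : ℕ, prolateEigen n ^ 2 = 2 * (sinIntegral (4 * π) / (4 * π) + 1) :=
  hasSum_prolateEigen_sq_sinIntegral.tsum_eq

/-- Every finite partial sum of `λ(n)²` is at most `Λ` (sharp form of the tree's Bessel bound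
`sum_sq_prolateEigen_le : Σ_{n∈s} λ(n)² ≤ 4`, `ProlateProjectionsAngleProofs.lean`). [cite: ConnesConsani2021, Remark 4.6 (i) §4 p. 18] -/
theorem sum_sq_prolateEigen_le_total (s : Finset ℕ) :
    ∑ n ∈ s, prolateEigen n ^ 2 ≤ 2 * (sinIntegral (4 * π) / (4 * π) + 1) :=
  sum_le_hasSum s (fun n _ ↦ sq_nonneg (prolateEigen n)) hasSum_prolateEigen_sq_sinIntegral

/-! ## The index-free tail over the complement of a finset -/

/-- **Tail mass, index-free**: for any finset `F`, `Σ_{n ∉ F} λ(n)² = Λ − Σ_{k∈F} λ(k)²`.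
[cite: ConnesConsani2021, Remark 4.6 (i) §4 p. 18] -/
theorem hasSum_sq_prolateEigen_compl (F : Finset ℕ) :
    HasSum (fun n : {n // n ∉ F} ↦ prolateEigen n ^ 2)
      (2 * (sinIntegral (4 * π) / (4 * π) + 1) - ∑ k ∈ F, prolateEigen k ^ 2) := by
  refine (Finset.hasSum_compl_iff (f := fun n : ℕ ↦ prolateEigen n ^ 2) F).2 ?_
  rw [sub_add_cancel]
  exact hasSum_prolateEigen_sq_sinIntegral

/-- `Σ'_{n ∉ F} λ(n)² = Λ − Σ_{k∈F} λ(k)²`. [cite: ConnesConsani2021, Remark 4.6 (i) §4 p. 18] -/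
theorem tsum_sq_prolateEigen_compl (F : Finset ℕ) :
    ∑' n : {n // n ∉ F}, prolateEigen n ^ 2 =
      2 * (sinIntegral (4 * π) / (4 * π) + 1) - ∑ k ∈ F, prolateEigen k ^ 2 :=
  (hasSum_sq_prolateEigen_compl F).tsum_eq

/-- The tail is summable. [cite: ConnesConsani2021, Remark 4.6 (i) §4 p. 18] -/
theorem summable_sq_prolateEigen_compl (F : Finset ℕ) :
    Summable (fun n : {n // n ∉ F} ↦ prolateEigen n ^ 2) :=
  (hasSum_sq_prolateEigen_compl F).summable

/-- **Usable tail bound**: a certified lower bound `M ≤ Σ_{k∈F} λ(k)²` gives `Σ'_{n ∉ F} λ(n)² ≤ Λ − M`.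
[cite: ConnesConsani2021, Remark 4.6 (i) §4 p. 18] -/
theorem tsum_sq_prolateEigen_compl_le {F : Finset ℕ} {M : ℝ} (hM : M ≤ ∑ k ∈ F, prolateEigen k ^ 2) :
    ∑' n : {n // n ∉ F}, prolateEigen n ^ 2 ≤ 2 * (sinIntegral (4 * π) / (4 * π) + 1) - M := by
  rw [tsum_sq_prolateEigen_compl]
  linarith

/-- Finite form of the tail bound: for `s` disjoint from `F` and `M ≤ Σ_{k∈F} λ(k)²`,
`Σ_{n∈s} λ(n)² ≤ Λ − M`. [cite: ConnesConsani2021, Remark 4.6 (i) §4 p. 18] -/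
theorem sum_sq_prolateEigen_le_of_disjoint {F s : Finset ℕ} {M : ℝ} (hM : M ≤ ∑ k ∈ F, prolateEigen k ^ 2)
    (hsF : Disjoint s F) :
    ∑ n ∈ s, prolateEigen n ^ 2 ≤ 2 * (sinIntegral (4 * π) / (4 * π) + 1) - M := by
  have h := sum_sq_prolateEigen_le_total (s ∪ F)
  rw [Finset.sum_union hsF] at h
  linarith

/-- One index outside `F`: `λ(m)² ≤ Λ − M` (the sharp form of `SlopeCert`'s `sq_prolateEigen_le_of_notMem`,
whose right-hand side is the crude `5/2 + 3/(2π) − M`). [cite: ConnesConsani2021, Remark 4.6 (i) §4 p. 18] -/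
theorem sq_prolateEigen_le_of_notMem' {F : Finset ℕ} {M : ℝ} (hM : M ≤ ∑ k ∈ F, prolateEigen k ^ 2)
    {m : ℕ} (hm : m ∉ F) :
    prolateEigen m ^ 2 ≤ 2 * (sinIntegral (4 * π) / (4 * π) + 1) - M := by
  have h := sum_sq_prolateEigen_le_of_disjoint (s := {m}) hM (Finset.disjoint_singleton_left.2 hm)
  rwa [Finset.sum_singleton] at h

/-! ## The numeral `Λ = 2(Si(4π)/(4π) + 1)` -/

/-- **Exact upper enclosure** from the four-term expansion of `Si` at `4π` (`cos 4π = 1`, `sin 4π = 0`):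
`Λ ≤ 9/4 − 2/(4π)² + 4/(4π)⁴ + 12/(4π)⁵`. [cite: ConnesConsani2021, Remark 4.6 (i) §4 p. 18 ("∼ 2.237484835")] -/
theorem two_mul_sinIntegral_div_add_one_le :
    2 * (sinIntegral (4 * π) / (4 * π) + 1) ≤
      9 / 4 - 2 / (4 * π) ^ 2 + 4 / (4 * π) ^ 4 + 12 / (4 * π) ^ 5 := by
  have hx : 0 < 4 * π := by positivity
  have hπ : π ≠ 0 := Real.pi_ne_zero
  have h := (abs_le.1 abs_sinIntegral_four_pi_sub_le).2
  have hSi : sinIntegral (4 * π) ≤ π / 2 - 1 / (4 * π) + 2 / (4 * π) ^ 3 + 6 / (4 * π) ^ 4 := by linarith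
  have key : 2 * (sinIntegral (4 * π) / (4 * π) + 1) = 2 + 2 / (4 * π) * sinIntegral (4 * π) := by
    field_simp
    ring
  rw [key]
  calc 2 + 2 / (4 * π) * sinIntegral (4 * π)
      ≤ 2 + 2 / (4 * π) * (π / 2 - 1 / (4 * π) + 2 / (4 * π) ^ 3 + 6 / (4 * π) ^ 4) := by
        gcongr
    _ = 9 / 4 - 2 / (4 * π) ^ 2 + 4 / (4 * π) ^ 4 + 12 / (4 * π) ^ 5 := by
        field_simp
        ring

/-- **Exact lower enclosure**: `9/4 − 2/(4π)² + 4/(4π)⁴ − 12/(4π)⁵ ≤ Λ`. [cite: ConnesConsani2021, Remark 4.6 (i) §4 p. 18 ("∼ 2.237484835")] -/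
theorem le_two_mul_sinIntegral_div_add_one :
    9 / 4 - 2 / (4 * π) ^ 2 + 4 / (4 * π) ^ 4 - 12 / (4 * π) ^ 5 ≤
      2 * (sinIntegral (4 * π) / (4 * π) + 1) := by
  have hx : 0 < 4 * π := by positivity
  have hπ : π ≠ 0 := Real.pi_ne_zero
  have h := (abs_le.1 abs_sinIntegral_four_pi_sub_le).1
  have hSi : π / 2 - 1 / (4 * π) + 2 / (4 * π) ^ 3 - 6 / (4 * π) ^ 4 ≤ sinIntegral (4 * π) := by linarith
  have key : 2 * (sinIntegral (4 * π) / (4 * π) + 1) = 2 + 2 / (4 * π) * sinIntegral (4 * π) := by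
    field_simp
    ring
  rw [key]
  calc 9 / 4 - 2 / (4 * π) ^ 2 + 4 / (4 * π) ^ 4 - 12 / (4 * π) ^ 5
      = 2 + 2 / (4 * π) * (π / 2 - 1 / (4 * π) + 2 / (4 * π) ^ 3 - 6 / (4 * π) ^ 4) := by
        field_simp
        ring
    _ ≤ 2 + 2 / (4 * π) * sinIntegral (4 * π) := by
        gcongr

/-- **Numeral**: `Λ = Σ_n λ(n)² ≤ 2.23754` (print: `2.237484835`). [cite: ConnesConsani2021, Remark 4.6 (i) §4 p. 18] -/
theorem two_mul_sinIntegral_div_add_one_le_numeral :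
    2 * (sinIntegral (4 * π) / (4 * π) + 1) ≤ 2.23754 := by
  have h := two_mul_sinIntegral_div_add_one_le
  have hlo : (12.566368 : ℝ) < 4 * π := by have := Real.pi_gt_d6; linarith
  have hhi : 4 * π < (12.566372 : ℝ) := by have := Real.pi_lt_d6; linarith
  have h0 : (0 : ℝ) < 12.566368 := by norm_num
  have h1 : 2 / (12.566372 : ℝ) ^ 2 ≤ 2 / (4 * π) ^ 2 := by gcongr
  have h2 : 4 / (4 * π) ^ 4 ≤ 4 / (12.566368 : ℝ) ^ 4 := by gcongr
  have h3 : 12 / (4 * π) ^ 5 ≤ 12 / (12.566368 : ℝ) ^ 5 := by gcongr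
  have hnum : (9 : ℝ) / 4 - 2 / 12.566372 ^ 2 + 4 / 12.566368 ^ 4 + 12 / 12.566368 ^ 5 ≤ 2.23754 := by
    norm_num
  linarith

/-- **Numeral**: `2.23745 ≤ Λ = Σ_n λ(n)²` (print: `2.237484835`). [cite: ConnesConsani2021, Remark 4.6 (i) §4 p. 18] -/
theorem numeral_le_two_mul_sinIntegral_div_add_one :
    (2.23745 : ℝ) ≤ 2 * (sinIntegral (4 * π) / (4 * π) + 1) := by
  have h := le_two_mul_sinIntegral_div_add_one
  have hlo : (12.566368 : ℝ) < 4 * π := by have := Real.pi_gt_d6; linarith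
  have hhi : 4 * π < (12.566372 : ℝ) := by have := Real.pi_lt_d6; linarith
  have h0 : (0 : ℝ) < 12.566368 := by norm_num
  have h1 : 2 / (4 * π) ^ 2 ≤ 2 / (12.566368 : ℝ) ^ 2 := by gcongr
  have h2 : 4 / (12.566372 : ℝ) ^ 4 ≤ 4 / (4 * π) ^ 4 := by gcongr
  have h3 : 12 / (4 * π) ^ 5 ≤ 12 / (12.566368 : ℝ) ^ 5 := by gcongr
  have hnum : (2.23745 : ℝ) ≤ 9 / 4 - 2 / 12.566368 ^ 2 + 4 / 12.566372 ^ 4 - 12 / 12.566368 ^ 5 := by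
    norm_num
  linarith

/-- **The tail as a numeral**: with a certified `M ≤ Σ_{k∈F} λ(k)²`, `Σ'_{n ∉ F} λ(n)² ≤ 2.23754 − M`.
[cite: ConnesConsani2021, Remark 4.6 (i) §4 p. 18; §4 p. 16 (λ(4) = 0.00273233, λ(5) = −0.0000762914)] -/
theorem tsum_sq_prolateEigen_compl_le_numeral {F : Finset ℕ} {M : ℝ}
    (hM : M ≤ ∑ k ∈ F, prolateEigen k ^ 2) :
    ∑' n : {n // n ∉ F}, prolateEigen n ^ 2 ≤ 2.23754 - M := by
  have h1 := tsum_sq_prolateEigen_compl_le hM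
  have h2 := two_mul_sinIntegral_div_add_one_le_numeral
  linarith

/-- Finite numeral form: `s` disjoint from `F`, `M ≤ Σ_{k∈F} λ(k)²` ⇒ `Σ_{n∈s} λ(n)² ≤ 2.23754 − M`.
[cite: ConnesConsani2021, Remark 4.6 (i) §4 p. 18] -/
theorem sum_sq_prolateEigen_le_numeral_of_disjoint {F s : Finset ℕ} {M : ℝ}
    (hM : M ≤ ∑ k ∈ F, prolateEigen k ^ 2) (hsF : Disjoint s F) :
    ∑ n ∈ s, prolateEigen n ^ 2 ≤ 2.23754 - M := by
  have h1 := sum_sq_prolateEigen_le_of_disjoint hM hsF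
  have h2 := two_mul_sinIntegral_div_add_one_le_numeral
  linarith

end Literature.NumberTheory.ConnesConsani2021

end
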